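import Mathlib
import Summits.ValiantsHypothesis.ValiantsHypothesis.Theorems.BarrierLeverPartitionMinorsHitByVPHiddenStatesShadowRankPairs

/-!
# Route BarrierLever — item `PartitionMinorsHitByVP` (stmt-ValiantsHypothesis-19717), line `hidden_states`:
# the pair span bound on a SUB-CUBE — rows outside `T` (or too large) count one by one

Helper file (`--supports stmt-ValiantsHypothesis-19717`; cell valiant-natproofs, rung V4, line `hidden_states`, node #1; prover seat
val-np-p3 gen 21; memo HOME/val-np-p3/g21/MEMO-bpwindow-valnp3-g21.md §1, §3(a), R4). Definition-free. Closes NO item.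

`ShadowRank.det_eq_zero_pairs` (val-np-p3 g19, p707760) needs ALL rows inside `T` of size `≤ s`. Since `row_mem_span_pairs` is per row,
the same count works when only SOME rows are small rows of `T`: those lie in the span `W` of the column-functions, every other row adds
at most one dimension. **`det_eq_zero_pairs_subcube`**: if

  `#{k : |e k| ≠ 2} + |S|·N + #{i : ¬(u i ⊆ T ∧ |u i| ≤ s)} < #columns + C(N,2)`   (`N = #{V ⊆ T : |V| ≤ q} ≤ |S|`, `s < 2(q+1)`)

then the additive matrix is singular FOR EVERY TABLE. This is the form in which the q-laws act at ambient `h` through every sub-cube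
`T ⊂ Fin h` (memo §3(a): the bands of every `h' ≤ h` apply at height `h`), and the «case B» bands of memo §1 (all small rows of `T` plus
arbitrary fillers). WHAT THIS IS NOT: nothing on crux 14610 or VP ≠ VNP.
-/

set_option linter.dupNamespace false

namespace Summit.ValiantsHypothesis.ValiantsHypothesis.Theorems.BarrierLever.HiddenStates

open Finset

noncomputable section

namespace ShadowRank

variable {K h : ℕ} {n : Type*} [Fintype n] [DecidableEq n] (u : n → Finset (Fin h)) (e : n → Finset (Fin K))
  (S : Finset (Fin K)) (T : Finset (Fin h)) (q : ℕ) (tx : Option (Fin K) → Fin h → ℂ)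

/-- **THE PAIR SPAN BOUND ON A SUB-CUBE.** Rows inside `T` of size `≤ s < 2(q+1)` lie in the span of the column-functions
(`row_mem_span_pairs`); every other row is counted once. If `#{k : |e k| ≠ 2} + |S|·N + #{other rows} < #columns + C(N,2)`
(`N = #{V ⊆ T : |V| ≤ q} ≤ |S|`), the additive matrix is singular for every table. -/
theorem det_eq_zero_pairs_subcube {s : ℕ} (hsq : s < 2 * (q + 1))
    (heS : ∀ k, (e k).card = 2 → e k ⊆ S) (hNS : (smallSets T q).card ≤ S.card)
    (hcount : (Finset.univ.filter fun k => (e k).card ≠ 2).card + S.card * (smallSets T q).card +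
      (Finset.univ.filter fun i => ¬ (u i ⊆ T ∧ (u i).card ≤ s)).card <
      Fintype.card n + ((smallSets T q).card).choose 2) :
    (Matrix.of fun i k : n => ∏ a ∈ u i, (tx none a + ∑ p ∈ e k, tx (some p) a)).det = 0 := by
  classical
  obtain ⟨S₀, hS₀, hcard₀, r, hδ, hcoord⟩ := exists_coords S T q tx
  set M : Matrix n n ℂ := Matrix.of fun i k : n => ∏ a ∈ u i, (tx none a + ∑ p ∈ e k, tx (some p) a) with hM
  by_contra hdet
  have hunit : IsUnit M := (Matrix.isUnit_iff_isUnit_det M).mpr (isUnit_iff_ne_zero.mpr hdet)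
  have hrows : LinearIndependent ℂ (fun i : n => M i) := Matrix.linearIndependent_rows_of_isUnit hunit
  set Bad : Finset n := Finset.univ.filter fun i => ¬ (u i ⊆ T ∧ (u i).card ≤ s) with hBad
  set W : Submodule ℂ (n → ℂ) := Submodule.span ℂ (Set.range (famVec e S S₀ r)) with hW
  set W₂ : Submodule ℂ (n → ℂ) := Submodule.span ℂ (Set.range fun i : ↥Bad => M i.1) with hW₂
  have hmem : ∀ i : n, M i ∈ W ⊔ W₂ := by
    intro i
    by_cases hi : u i ⊆ T ∧ (u i).card ≤ s
    · exact Submodule.mem_sup_left (row_mem_span_pairs u e S S₀ T q tx r hsq heS hS₀ hδ hcoord i hi.1 hi.2)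
    · have hiB : i ∈ Bad := by rw [hBad, Finset.mem_filter]; exact ⟨Finset.mem_univ _, hi⟩
      exact Submodule.mem_sup_right (Submodule.subset_span ⟨⟨i, hiB⟩, rfl⟩)
  let w : n → ↥(W ⊔ W₂) := fun i => ⟨M i, hmem i⟩
  have hw : LinearIndependent ℂ w := LinearIndependent.of_comp (W ⊔ W₂).subtype hrows
  have h1 : Fintype.card n ≤ Module.finrank ℂ ↥(W ⊔ W₂) := hw.fintype_card_le_finrank
  have h2 : Module.finrank ℂ W ≤ Fintype.card (PIdx e S S₀) := finrank_range_le_card (famVec e S S₀ r)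
  have h3 : Module.finrank ℂ W₂ ≤ Bad.card := by
    have := finrank_range_le_card (R := ℂ) (fun i : ↥Bad => M i.1)
    rwa [Fintype.card_coe] at this
  have h4 : Module.finrank ℂ ↥(W ⊔ W₂) ≤ Module.finrank ℂ W + Module.finrank ℂ W₂ :=
    Submodule.finrank_add_le_finrank_add_finrank W W₂
  rw [card_PIdx] at h2
  have key := count_le (N := (smallSets T q).card) (Finset.card_sdiff_add_card_eq_card hS₀) hcard₀ hNS
  omega

end ShadowRank

end

end Summit.ValiantsHypothesis.ValiantsHypothesis.Theorems.BarrierLever.HiddenStates
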